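import Literature.Computability.AlgebraicComplexity.LMR13PLambdaStabilizerBlockI
import Literature.Computability.AlgebraicComplexity.LMR13PLambdaStabilizerBlockII
import HarnessLib

/-!
# LMR13 §3.5, stabiliser of `P_Λ`: block (III-a) — the `Φ`-step (diagonal form of `(L_X A)_skew`)

[topic Computability/AlgebraicComplexity]

Landsberg–Manivel–Ressayre 2013, §3.5 (p. 481). Elementary route (cell memo
`HOME/lmr/X3b-ELEMENTARY-ROUTE-t10g4.md` §5, first bullet): for `X ∈ 𝔤𝔩(W)_{P_Λ}` (`n = m+1` odd) with
vanishing functionals `Φ_{ra} = (L_X(E_ra + E_ar))_{rr}` (`r ≠ a`), identity (III) of `pLambda_glAnn_blocks` at the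
sparse point `R_r(Ω)` against `S = E_rk + E_kr` gives `D(R_rΩ, α(R_rΩ))_{rk} = 0`, hence (row formula
`adjDeriv_padAt_row_vecMul`) the `r`-th row of `α(R_rΩ) := (L_X R_rΩ)_skew` vanishes; by pair-differences of signed
matching matrices, **the `r`-th row of `α(E_ab − E_ba)` vanishes for every `r ∉ {a,b}`** — `α(E_ab − E_ba)` is
supported on `{(a,b),(b,a)}` (`skewPart_linAct_wedge_apply_eq_zero`).

Theorems only; no named fact. Honest framing: a step of (X3b); `LMR2013_prop_3_5_1` remains OPEN in the tree
for `n > 3`; VP ≠ VNP is NOT proved and nothing here is progress on it.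

## References

* [LandsbergManivelRessayre2013] J. M. Landsberg, L. Manivel, N. Ressayre, *Hypersurfaces with degenerate duals and
  the geometric complexity theory program*, Comment. Math. Helv. 88 (2013) 469–484, §3.5 (p. 481).
-/

noncomputable section

open Matrix

namespace Literature.Computability.AlgebraicComplexity

namespace SkewAdj

variable {m : ℕ}

/-- The skew part of `L_X` is compatible with subtraction and scalars in the matrix argument.
[cite: LandsbergManivelRessayre2013, §3.5 (p. 481)] -/
theorem skewPart_linAct_sub_smul (X : Matrix (Fin m × Fin m) (Fin m × Fin m) ℂ) (M M' : Matrix (Fin m) (Fin m) ℂ)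
    (c : ℂ) :
    (1 / 2 : ℂ) • ((Matrix.of fun k l => ∑ p : Fin m × Fin m, X p (k, l) * (M - c • M') p.1 p.2) -
        (Matrix.of fun k l => ∑ p : Fin m × Fin m, X p (k, l) * (M - c • M') p.1 p.2)ᵀ) =
      (1 / 2 : ℂ) • ((Matrix.of fun k l => ∑ p : Fin m × Fin m, X p (k, l) * M p.1 p.2) -
          (Matrix.of fun k l => ∑ p : Fin m × Fin m, X p (k, l) * M p.1 p.2)ᵀ) -
        c • ((1 / 2 : ℂ) • ((Matrix.of fun k l => ∑ p : Fin m × Fin m, X p (k, l) * M' p.1 p.2) -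
          (Matrix.of fun k l => ∑ p : Fin m × Fin m, X p (k, l) * M' p.1 p.2)ᵀ)) := by
  rw [linAct_sub, linAct_smul, Matrix.transpose_sub, Matrix.transpose_smul]
  ext k l
  simp only [Matrix.smul_apply, Matrix.sub_apply, Matrix.transpose_apply, smul_eq_mul]
  ring

/-- **Block (III) at `R_r(Ω)` against `S = E_rK + E_Kr`**: with `Φ_{rK} = 0`, the `(r,K)` entry of
`D(R_rΩ, (L_X R_rΩ)_skew)` vanishes. [cite: LandsbergManivelRessayre2013, §3.5 (p. 481)] -/
theorem adjDeriv_padAt_skewPart_apply_eq_zero (hm : Odd (m + 1))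
    {X : Matrix (Fin (m + 1) × Fin (m + 1)) (Fin (m + 1) × Fin (m + 1)) ℂ} (hX : X ∈ glAnn (pLambda (m + 1)))
    (hΦ : ∀ r a : Fin (m + 1), r ≠ a →
      (Matrix.of fun k l => ∑ p : Fin (m + 1) × Fin (m + 1), X p (k, l) *
        (Matrix.single r a (1 : ℂ) + Matrix.single a r (1 : ℂ)) p.1 p.2) r r = 0)
    (r : Fin (m + 1)) {Ω : Matrix (Fin m) (Fin m) ℂ} (hΩ : Ωᵀ = -Ω) (k : Fin m) :
    adjDeriv (padAt r Ω) ((1 / 2 : ℂ) •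
      ((Matrix.of fun k l => ∑ p : Fin (m + 1) × Fin (m + 1), X p (k, l) * padAt r Ω p.1 p.2) -
        (Matrix.of fun k l => ∑ p : Fin (m + 1) × Fin (m + 1), X p (k, l) * padAt r Ω p.1 p.2)ᵀ))
      r (r.succAbove k) = 0 := by
  set R₀ := padAt r Ω with hR₀
  have hR₀skew : R₀ᵀ = -R₀ := by
    rw [hR₀, padAt_transpose, hΩ]
    ext a b
    rcases Fin.eq_self_or_eq_succAbove r a with rfl | ⟨a', rfl⟩
    · simp
    · rcases Fin.eq_self_or_eq_succAbove r b with rfl | ⟨b', rfl⟩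
      · simp
      · simp
  have hcard : Odd (Fintype.card (Fin (m + 1))) := by rwa [Fintype.card_fin]
  set α₀ := (1 / 2 : ℂ) • ((Matrix.of fun k l => ∑ p : Fin (m + 1) × Fin (m + 1), X p (k, l) * R₀ p.1 p.2) -
    (Matrix.of fun k l => ∑ p : Fin (m + 1) × Fin (m + 1), X p (k, l) * R₀ p.1 p.2)ᵀ) with hα₀
  have hα₀skew : α₀ᵀ = -α₀ := by
    rw [hα₀, Matrix.transpose_smul, Matrix.transpose_sub, Matrix.transpose_transpose, ← smul_neg, neg_sub]
  set K := r.succAbove k with hK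
  have hrK : r ≠ K := (Fin.succAbove_ne r k).symm
  set S : Matrix (Fin (m + 1)) (Fin (m + 1)) ℂ := Matrix.single r K (1 : ℂ) + Matrix.single K r 1 with hS_def
  have hS : Sᵀ = S := by
    rw [hS_def, Matrix.transpose_add, Matrix.transpose_single, Matrix.transpose_single]
    exact add_comm _ _
  have h3 := (pLambda_glAnn_blocks (Nat.succ_ne_zero m) hX hR₀skew hS).2.1
  -- the `adj` term: `det Ω · Φ_{rK} = 0`
  have htr1 : ∀ N : Matrix (Fin (m + 1)) (Fin (m + 1)) ℂ,
      Matrix.trace (Matrix.single r r (1 : ℂ) * N) = N r r := by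
    intro N
    simp only [Matrix.trace, Matrix.diag]
    rw [Fintype.sum_eq_single r (fun a ha => Matrix.single_mul_apply_of_ne (c := (1 : ℂ)) r r a a ha _),
      Matrix.single_mul_apply_same, one_mul]
  have hadj : Matrix.trace (R₀.adjugate * ((1 / 2 : ℂ) •
      ((Matrix.of fun k l => ∑ p : Fin (m + 1) × Fin (m + 1), X p (k, l) * S p.1 p.2) +
        (Matrix.of fun k l => ∑ p : Fin (m + 1) × Fin (m + 1), X p (k, l) * S p.1 p.2)ᵀ))) = 0 := by
    rw [hR₀, adjugate_padAt, Matrix.smul_mul, Matrix.trace_smul, htr1, Matrix.smul_apply, Matrix.add_apply,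
      Matrix.transpose_apply, hS_def, hΦ r K hrK, add_zero, smul_zero, smul_zero]
  rw [hadj, zero_add] at h3
  -- the `D` term: `tr(D·S) = 2 D_{rK}`
  have htr : ∀ (M : Matrix (Fin (m + 1)) (Fin (m + 1)) ℂ) (i j : Fin (m + 1)),
      Matrix.trace (M * Matrix.single i j (1 : ℂ)) = M j i := by
    intro M i j
    simp only [Matrix.trace, Matrix.diag]
    rw [Fintype.sum_eq_single j (fun a ha => Matrix.mul_single_apply_of_ne (c := (1 : ℂ)) i j a a ha M),
      Matrix.mul_single_apply_same, mul_one]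
  have hDsym : (adjDeriv R₀ α₀)ᵀ = adjDeriv R₀ α₀ := adjDeriv_transpose hcard hR₀skew hα₀skew
  rw [hS_def, Matrix.mul_add, Matrix.trace_add, htr, htr] at h3
  have hsym : adjDeriv R₀ α₀ K r = adjDeriv R₀ α₀ r K := by
    rw [← Matrix.transpose_apply (adjDeriv R₀ α₀) r K, hDsym]
  rw [hsym, ← two_mul, mul_eq_zero] at h3
  exact h3.resolve_left two_ne_zero

/-- **The `r`-th row of `(L_X R_rΩ)_skew` vanishes** (given `Φ = 0`; `Ω` invertible skew): from
`adjDeriv_padAt_skewPart_apply_eq_zero` and the row formula `adjDeriv_padAt_row_vecMul`.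
[cite: LandsbergManivelRessayre2013, §3.5 (p. 481)] -/
theorem skewPart_linAct_padAt_row_eq_zero (hm : Odd (m + 1))
    {X : Matrix (Fin (m + 1) × Fin (m + 1)) (Fin (m + 1) × Fin (m + 1)) ℂ} (hX : X ∈ glAnn (pLambda (m + 1)))
    (hΦ : ∀ r a : Fin (m + 1), r ≠ a →
      (Matrix.of fun k l => ∑ p : Fin (m + 1) × Fin (m + 1), X p (k, l) *
        (Matrix.single r a (1 : ℂ) + Matrix.single a r (1 : ℂ)) p.1 p.2) r r = 0)
    (r : Fin (m + 1)) {Ω : Matrix (Fin m) (Fin m) ℂ} (hΩ : Ωᵀ = -Ω) (hΩu : IsUnit Ω.det) (j : Fin m) :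
    ((1 / 2 : ℂ) • ((Matrix.of fun k l => ∑ p : Fin (m + 1) × Fin (m + 1), X p (k, l) * padAt r Ω p.1 p.2) -
        (Matrix.of fun k l => ∑ p : Fin (m + 1) × Fin (m + 1), X p (k, l) * padAt r Ω p.1 p.2)ᵀ))
      r (r.succAbove j) = 0 := by
  set α₀ := (1 / 2 : ℂ) • ((Matrix.of fun k l => ∑ p : Fin (m + 1) × Fin (m + 1), X p (k, l) * padAt r Ω p.1 p.2) -
    (Matrix.of fun k l => ∑ p : Fin (m + 1) × Fin (m + 1), X p (k, l) * padAt r Ω p.1 p.2)ᵀ) with hα₀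
  have hα₀skew : α₀ᵀ = -α₀ := by
    rw [hα₀, Matrix.transpose_smul, Matrix.transpose_sub, Matrix.transpose_transpose, ← smul_neg, neg_sub]
  have hrow := adjDeriv_padAt_row_vecMul hm r hΩ hα₀skew
  have hzero : (fun k => adjDeriv (padAt r Ω) α₀ r (r.succAbove k)) = 0 := by
    funext k
    exact adjDeriv_padAt_skewPart_apply_eq_zero hm hX hΦ r hΩ k
  rw [hzero, Matrix.zero_vecMul] at hrow
  have h := congrFun hrow j
  rw [Pi.zero_apply, eq_comm, neg_eq_zero, mul_eq_zero] at h
  rcases h with h | h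
  · exact absurd h hΩu.ne_zero
  · exact h

/-- **Block (III-a), the `Φ`-step** (memo §5): for `X ∈ 𝔤𝔩(W)_{P_Λ}` (`n = h+h+1`) with `Φ = 0`, and `a ≠ b`
among the indices `≠ r`, the `r`-th row of `α(E_AB − E_BA) = (L_X(E_AB − E_BA))_skew` vanishes
(`A = r.succAbove a`, `B = r.succAbove b`) — pair-difference of `skewPart_linAct_padAt_row_eq_zero` at the signed
matching matrices `J(π,s)`, `J(π,bump s)` with `π a = b`. [cite: LandsbergManivelRessayre2013, §3.5 (p. 481)] -/
theorem skewPart_linAct_wedge_row_eq_zero {h : ℕ}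
    {X : Matrix (Fin (h + h + 1) × Fin (h + h + 1)) (Fin (h + h + 1) × Fin (h + h + 1)) ℂ}
    (hX : X ∈ glAnn (pLambda (h + h + 1)))
    (hΦ : ∀ r a : Fin (h + h + 1), r ≠ a →
      (Matrix.of fun k l => ∑ p : Fin (h + h + 1) × Fin (h + h + 1), X p (k, l) *
        (Matrix.single r a (1 : ℂ) + Matrix.single a r (1 : ℂ)) p.1 p.2) r r = 0)
    (r : Fin (h + h + 1)) {a b : Fin (h + h)} (hab : a ≠ b) (j : Fin (h + h + 1)) :
    ((1 / 2 : ℂ) • ((Matrix.of fun k l => ∑ p : Fin (h + h + 1) × Fin (h + h + 1), X p (k, l) *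
        (Matrix.single (r.succAbove a) (r.succAbove b) (1 : ℂ) -
          Matrix.single (r.succAbove b) (r.succAbove a) (1 : ℂ)) p.1 p.2) -
      (Matrix.of fun k l => ∑ p : Fin (h + h + 1) × Fin (h + h + 1), X p (k, l) *
        (Matrix.single (r.succAbove a) (r.succAbove b) (1 : ℂ) -
          Matrix.single (r.succAbove b) (r.succAbove a) (1 : ℂ)) p.1 p.2)ᵀ)) r j = 0 := by
  -- diagonal entry: the matrix is skew
  rcases Fin.eq_self_or_eq_succAbove r j with rfl | ⟨j', rfl⟩
  · simp only [Matrix.smul_apply, Matrix.sub_apply, Matrix.transpose_apply, sub_self, smul_zero]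
  have hm : Odd (h + h + 1) := ⟨h, by ring⟩
  obtain ⟨π, hπ, hfix, hπa⟩ := exists_involution_apply_eq hab
  set s : Fin (h + h) → ℂ := fun x => if x < π x then (1 : ℂ) else -1 with hs_def
  have hs : ∀ x, s (π x) = -s x := signWeight_antisymm hπ hfix
  have hs0 : ∀ x, s x ≠ 0 := signWeight_ne_zero π
  have e1 := skewPart_linAct_padAt_row_eq_zero hm hX hΦ r (pairMat_transpose hπ hs) (isUnit_det_pairMat hπ hs hs0) j'
  have e2 := skewPart_linAct_padAt_row_eq_zero hm hX hΦ r (pairMat_transpose hπ (bumpWeight_antisymm hπ hs a))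
    (isUnit_det_pairMat hπ (bumpWeight_antisymm hπ hs a) (bumpWeight_ne_zero π hs0 a)) j'
  -- the difference of the two padded points is `s_a • (E_AB − E_BA)`
  have hdiff : padAt r (pairMat π (bumpWeight π s a)) - s a • (Matrix.single (r.succAbove a) (r.succAbove b) (1 : ℂ) -
      Matrix.single (r.succAbove b) (r.succAbove a) (1 : ℂ)) = padAt r (pairMat π s) := by
    rw [← padAt_single, ← padAt_single, ← hπa, ← padAt_sub r (Matrix.single a (π a) (1 : ℂ)), ← padAt_smul,
      ← pairMat_bumpWeight_sub hπ hfix hs, ← padAt_sub, sub_sub_cancel]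
  have key := congrFun (congrFun (skewPart_linAct_sub_smul X (padAt r (pairMat π (bumpWeight π s a)))
    (Matrix.single (r.succAbove a) (r.succAbove b) (1 : ℂ) - Matrix.single (r.succAbove b) (r.succAbove a) (1 : ℂ))
    (s a)) r) (r.succAbove j')
  rw [hdiff, e1, Matrix.sub_apply, e2, Matrix.smul_apply, smul_eq_mul, zero_sub, eq_comm, neg_eq_zero,
    mul_eq_zero] at key
  rcases key with key | key
  · exact absurd key (hs0 a)
  · exact key

/-- **Block (III-a) in absolute indices**: for pairwise distinct `a, b, r` and every `j`,
`((L_X(E_ab − E_ba))_skew)_{rj} = 0` — `α(E_ab − E_ba)` is supported on `{(a,b),(b,a)}`.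
[cite: LandsbergManivelRessayre2013, §3.5 (p. 481)] -/
theorem skewPart_linAct_wedge_apply_eq_zero {h : ℕ}
    {X : Matrix (Fin (h + h + 1) × Fin (h + h + 1)) (Fin (h + h + 1) × Fin (h + h + 1)) ℂ}
    (hX : X ∈ glAnn (pLambda (h + h + 1)))
    (hΦ : ∀ r a : Fin (h + h + 1), r ≠ a →
      (Matrix.of fun k l => ∑ p : Fin (h + h + 1) × Fin (h + h + 1), X p (k, l) *
        (Matrix.single r a (1 : ℂ) + Matrix.single a r (1 : ℂ)) p.1 p.2) r r = 0)
    {a b r : Fin (h + h + 1)} (hab : a ≠ b) (hra : r ≠ a) (hrb : r ≠ b) (j : Fin (h + h + 1)) :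
    ((1 / 2 : ℂ) • ((Matrix.of fun k l => ∑ p : Fin (h + h + 1) × Fin (h + h + 1), X p (k, l) *
        (Matrix.single a b (1 : ℂ) - Matrix.single b a (1 : ℂ)) p.1 p.2) -
      (Matrix.of fun k l => ∑ p : Fin (h + h + 1) × Fin (h + h + 1), X p (k, l) *
        (Matrix.single a b (1 : ℂ) - Matrix.single b a (1 : ℂ)) p.1 p.2)ᵀ)) r j = 0 := by
  obtain ⟨a', rfl⟩ := Fin.exists_succAbove_eq (Ne.symm hra)
  obtain ⟨b', rfl⟩ := Fin.exists_succAbove_eq (Ne.symm hrb)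
  have hab' : a' ≠ b' := fun h' => hab (by rw [h'])
  exact skewPart_linAct_wedge_row_eq_zero hX hΦ r hab' j

end SkewAdj

end Literature.Computability.AlgebraicComplexity

end
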